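import Literature.NumberTheory.Rogawski1990.SemilocalCharactersLinIndep          -- ★ p823359: the LETTER #85 `SemilocalCharactersLinIndep`, `ArchTestKc`; ★ `archTr₀`, ★ `GKIrrep.IsInfUnitaryAlongP`
import Literature.NumberTheory.Rogawski1990.ArchCharactersLinIndep               -- ★ p825905: the ARCHIMEDEAN LETTER `Rogawski1990.ArchCharactersLinIndep` (its `.eq_zero` field)
import Literature.NumberTheory.Automorphic.SmoothTraceLinearIndependenceUnitary   -- ★ (U3) `IrrClass.eq_zero_of_summable_mul_smoothTrace` (the p-adic factor, PROVED)
import Literature.NumberTheory.Automorphic.LocalUnitaryIntegralLevel              -- ★ `cmLocalIntegralLevel`, `isCompact_isOpen_cmLocalIntegralLevel`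
import Literature.NumberTheory.Automorphic.CharacterLinIndepProduct               -- ★ p826239: `eq_zero_of_piFinset` (finite product step, PROVED)
import Literature.NumberTheory.Automorphic.SmoothTraceCountableSupport             -- ★ p826521: `countable_support_of_summable_mul_smoothTrace_cmDatum` (PROVED)
import Summits.HodgeConjecture.HodgeConjecture.Theorems.F0T1aArchRealCaseU21   -- ★ p835479: `F0T1aArchRealCaseU21.archCharactersLinIndep_of_letters_u21` (arch letter ⇐ A5 + A6 at (2,1) + A7′)
import Literature.NumberTheory.Automorphic.HasUnitaryGlobalizationOfInfUnitaryU21  -- ★ p835686: `hasUnitaryGlobalization_of_isInfUnitary_uTwoOne` (A6 AT U(2,1), PROVED IN-HOUSE)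
import Literature.NumberTheory.Automorphic.UnitaryGroupArchCharacterTraceClassOfKTypeGrowthU21  -- ★ p831233: C1′ `archIntegratedOperatorTraceClass_forall_of_kTypeGrowthU21`
import Literature.NumberTheory.Automorphic.U21IrreducibleUnitaryKTypeGrowthProofs         -- ★ p832682: `kTypeGrowth_uTwoOne` (V19 AT U(2,1), PROVED IN-HOUSE)
import Summits.HodgeConjecture.HodgeConjecture.Theorems.F0P3LocalIrrepAdmissibleThree  -- ★ p831854: `localIrrepAdmissible_three_all` (adm at N = 3)
import Literature.NumberTheory.Automorphic.UnitaryGlobalizationIrreducibleProofs  -- ★ p828784: `unitaryGlobalizationIrreducible_holds` (A7′)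
import HarnessLib

/-!
# `F0T1bSemilocalCharactersLinIndepOfStubs` — the SORRY-FREE Theorems twin of the registered root line
# `Cruxes/H413/Lines/F0_T1b_SemilocalCharactersLinIndep.lean` (ED. 9, tree b8e2568ab159b5a2, sorries 0): the letter #85
# `Rogawski1990.SemilocalCharactersLinIndep` AT EVERY FRAME AND EVERY PAIR OF MEASURES, hypothesis-free, no `Lines` import

Cell `hodgecm-mathlib`, F0∕P3 «U3-mult», crux H413; director g17 s715 (3)(b) 2026-08-31T22:10:10Z («keep O50-1: a THEOREMS TWIN … the T1b head re-proved over the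
same ★ imports, sorry-free»; precedent ★ p834307 `F0P3KeysCaseTwoOfStubs`), host desk F0P3b-plan (g10), pen A-p14 (g24).  PURPOSE: the rung-1 closer
`Cruxes/H413/Lines/F0_U3LettersRung1.lean` can write **`stub_L2SA := F0T1bSemilocalCharactersLinIndepOfStubs.semilocalCharactersLinIndep_all`** BY NAME — the type of
`semilocalCharactersLinIndep_all` is the closer's `StubL2SA` body token for token.

THEOREMS ONLY: no `def`, no instance, no notation, no `sorry`, no named fact (the line's one `Prop` abbreviation `SemilocalCharactersLinIndepClosed` is INLINED as the
explicit `∀`-statement).  Contents (all proved; axioms TRIO): `local_eq_zero` (the `p`-adic factor at one place for all coefficient functions: ★ (U3) + admissibility +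
countable support — verbatim from the line §2) · `semilocalCharactersLinIndep_of_letters` (the line's kernel-checked composition §4 with its five input TEXTS as
hypotheses: arch factor `h1`, admissibility `h3`, frame `h3'`, countable support `h7`, finite-product step `h4`) · `semilocalCharactersLinIndep_all` (HYPOTHESIS-FREE:
the five texts discharged by ★ `F0T1aArchRealCaseU21.archCharactersLinIndep_of_letters_u21` fed with ★ C1′ ∘ ★ V19-at-(2,1), ★ A6-at-(2,1)
`hasUnitaryGlobalization_of_isInfUnitary_uTwoOne`, ★ A7′ `unitaryGlobalizationIrreducible_holds`; ★ `localIrrepAdmissible_three_all`; ★ `Rogawski1990.transpose_map_cmConjRingHom_eq_of_frame` ∕ `isUnit_det_of_frame`;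
★ `countable_support_of_summable_mul_smoothTrace_cmDatum`; ★ `eq_zero_of_piFinset`) · `semilocalCharactersLinIndep_holds` (read-back at a frame).

HONEST LABEL: #85 (L2-SA) [Rogawski1990 Prop. 13.8.1] is hereby a theorem of the tree at `N = 3` with NO printed letter left inside it (A5, A6 at (2,1), A7′, adm at
`N = 3`, V19 at (2,1) all proved in-house); HC_CM itself is proved only modulo the 2 remaining named inputs (hLiu418, h413) until rung 0 closes — this file moves
the closer's registry `stub_L2SA` only.

THE PRINT.  [Rogawski1990, Prop. 13.8.1 p. 212] («consequence of [JL], Lemma 16.1.1 (cf. [LL], page 768)»); [JacquetLanglands1970, Lemma 16.1.1 pp. 497–499];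
[LabesseLanglands1979, Lemma 6.1 pp. 768–769]: positivity + Hilbert–Schmidt for ONE group, products on pure tensors by fibre regrouping.
-/

-- Mathlib idiom (Mathlib/Algebra/Lie/OfAssociative.lean; as in the ★ letter file and the line): the commutator bracket on `Module.End ℂ V`, to MENTION `r.IsInfUnitaryAlongP`.
attribute [local instance 100] LieRing.ofAssociativeRing

set_option autoImplicit false
set_option linter.dupNamespace false

noncomputable section

open NumberField IsDedekindDomain MeasureTheory
open Literature.NumberTheory.Rogawski1990 Literature.NumberTheory.Automorphic Literature.NumberTheory.Automorphic.UnitaryGroup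
open Literature.RepresentationTheory.KonnoKonno2007
open scoped Matrix Classical ComplexOrder

namespace Summit.HodgeConjecture.HodgeConjecture.Cruxes.H413.F0T1bSemilocalCharactersLinIndepOfStubs

/-! ## §1 The finite-place factor in coefficient-function form (PROVED from ★ (U3) + admissibility + countable support) -/

/-- **The `p`-adic factor at one place, for ALL coefficient functions**: for `H` hermitian with unit determinant, a Haar measure `μ` on `G′_v = U(H)(L⁺_v)` and
`b : IrrClass G′_v → ℂ` supported on UNITARIZABLE classes, if `x ↦ b x · tr x(t)` is summable with sum `0` for every `t ∈ C_c^∞(G′_v)` then `b = 0`.  From ★ (U3)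
`IrrClass.eq_zero_of_summable_mul_smoothTrace` (countable injective families of admissible unitarizable classes; `K₀ := U(H)(𝒪_v)`, ★
`isCompact_isOpen_cmLocalIntegralLevel`) through admissibility (stub (adm)) and countable support (stub (count)). [cite: Rogawski1990, Prop. 13.8.1 p. 212]
[cite: JacquetLanglands1970, Lemma 16.1.1] -/
theorem local_eq_zero (L : Type) [Field L] [NumberField L] [IsCMField L] (N : ℕ) (H : Matrix (Fin N) (Fin N) L)
    (v : HeightOneSpectrum (𝓞 ↥(maximalRealSubfield L)))
    (μ : @Measure ((cmDatum L N H).Local v) (borel _)) (hμ : @Measure.IsHaarMeasure _ _ _ (borel _) μ)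
    (hadm : ∀ c : IrrClass ((cmDatum L N H).Local v), c.IsAdmissible)
    (hcount : ∀ b : IrrClass ((cmDatum L N H).Local v) → ℂ, (∀ x, b x ≠ 0 → x.IsAdmissible) →
      (∀ t : (cmDatum L N H).Local v → ℂ, IsLocallyConstant t ∧ HasCompactSupport t →
        Summable fun x => b x * (letI : MeasurableSpace ((cmDatum L N H).Local v) := borel _; x.smoothTrace μ t)) →
      (Function.support b).Countable)
    (b : IrrClass ((cmDatum L N H).Local v) → ℂ) (hb : ∀ x, b x ≠ 0 → x.IsUnitarizable)
    (hs : ∀ t : (cmDatum L N H).Local v → ℂ, IsLocallyConstant t ∧ HasCompactSupport t →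
      Summable fun x => b x * (letI : MeasurableSpace ((cmDatum L N H).Local v) := borel _; x.smoothTrace μ t))
    (h0 : ∀ t : (cmDatum L N H).Local v → ℂ, IsLocallyConstant t ∧ HasCompactSupport t →
      ∑' x, b x * (letI : MeasurableSpace ((cmDatum L N H).Local v) := borel _; x.smoothTrace μ t) = 0)
    (x : IrrClass ((cmDatum L N H).Local v)) : b x = 0 := by
  letI : MeasurableSpace ((cmDatum L N H).Local v) := borel _
  haveI : BorelSpace ((cmDatum L N H).Local v) := ⟨rfl⟩
  haveI : μ.IsHaarMeasure := hμ
  by_contra hx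
  -- the support of `b` is countable
  have hcnt : (Function.support b).Countable := hcount b (fun x _ => hadm x) hs
  haveI : Countable ↥(Function.support b) := hcnt.to_subtype
  -- ★ (U3) on the countable injective family `Subtype.val : support b → IrrClass G′_v`
  have hK := isCompact_isOpen_cmLocalIntegralLevel L N H v
  have hzero := IrrClass.eq_zero_of_summable_mul_smoothTrace (G := (cmDatum L N H).Local v) μ (cmLocalIntegralLevel L N H v) hK.2 hK.1
    (ι := ↥(Function.support b)) (fun i => (i : IrrClass ((cmDatum L N H).Local v))) Subtype.val_injective
    (fun i => ⟨hadm i, hb i i.2⟩) (fun i => b i) (fun f hf => by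
      have hf' : IsLocallyConstant f ∧ HasCompactSupport f := (mem_schwartzBruhat_iff).1 hf
      refine ⟨(hs f hf').subtype _, ?_⟩
      rw [tsum_subtype_eq_of_support_subset (s := Function.support b)
        (f := fun x => b x * x.smoothTrace μ f) (Function.support_mul_subset_left _ _)]
      exact h0 f hf')
  have := congr_fun hzero ⟨x, hx⟩
  exact hx this

/-! ## §2 The kernel-checked composition: the five input TEXTS imply the letter at every frame -/

/-- **#85 FROM ITS FIVE INPUT TEXTS** (composition; = the line's `semilocalCharactersLinIndep_of_stubs` with the head `def` inlined): unfold the letter; the frame text `h3'` supplies the hermitian ∕ unit-determinant hypotheses of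
the admissibility text `h3`; the finite-place factor at each `v ∈ S` is `local_eq_zero` (★ (U3) + (adm) + (count)); the archimedean factor is `h1`;
the finite-product text `h4` regroups the product characters on pure tensors. [cite: Rogawski1990, Prop. 13.8.1 p. 212] [cite: LabesseLanglands1979, Lemma 6.1 pp. 768–769] -/
theorem semilocalCharactersLinIndep_of_letters
    (h1 : ∀ (L : Type) [Field L] [NumberField L] [IsCMField L] (ι : L →+* ℂ) (H : Matrix (Fin 3) (Fin 3) L) (T : GL (Fin 3) ℂ)
      (hT : (T : Matrix (Fin 3) (Fin 3) ℂ)ᴴ * H.map ι * (T : Matrix (Fin 3) (Fin 3) ℂ) = Literature.Geometry.ComplexHyperbolic.BallModel.J)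
      (νinf : @Measure (UnitaryGroup.arch (↥(maximalRealSubfield L)) L (IsCMField.complexConj L) 3 H) (borel _)),
      (∀ τ' : L →+* ℂ, InfinitePlace.mk τ' ≠ InfinitePlace.mk ι → (H.map τ').PosDef) →
      @Measure.IsHaarMeasure _ _ _ (borel _) νinf →
      ∀ b : GKIrrClass (uFormGroup (Fin 2) (Fin 1)) → ℂ,
        (∀ y, b y ≠ 0 → ∃ r : GKIrrep (uFormGroup (Fin 2) (Fin 1)), GKIrrClass.mk r = y ∧ IsAdmissibleGK r.ρK ∧ r.IsInfUnitaryAlongP) →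
        (∀ φ : UnitaryGroup.arch (↥(maximalRealSubfield L)) L (IsCMField.complexConj L) 3 H → ℂ,
          ArchTestKc L ι H T hT φ → Summable fun y => b y * archTr₀ L ι H T hT νinf y φ) →
        (∀ φ : UnitaryGroup.arch (↥(maximalRealSubfield L)) L (IsCMField.complexConj L) 3 H → ℂ,
          ArchTestKc L ι H T hT φ → ∑' y, b y * archTr₀ L ι H T hT νinf y φ = 0) →
        ∀ y, b y = 0)
    (h3 : ∀ (L : Type) [Field L] [NumberField L] [IsCMField L] (H : Matrix (Fin 3) (Fin 3) L),
      (H.map (cmConjRingHom L))ᵀ = H → IsUnit H.det →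
      ∀ (v : HeightOneSpectrum (𝓞 ↥(maximalRealSubfield L))) (c : IrrClass ((cmDatum L 3 H).Local v)), c.IsAdmissible)
    (h3' : ∀ (L : Type) [Field L] [NumberField L] [IsCMField L] (ι : L →+* ℂ) (H : Matrix (Fin 3) (Fin 3) L) (T : GL (Fin 3) ℂ),
      (T : Matrix (Fin 3) (Fin 3) ℂ)ᴴ * H.map ι * (T : Matrix (Fin 3) (Fin 3) ℂ) = Literature.Geometry.ComplexHyperbolic.BallModel.J →
      (H.map (cmConjRingHom L))ᵀ = H ∧ IsUnit H.det)
    (h7 : ∀ (L : Type) [Field L] [NumberField L] [IsCMField L] (N : ℕ) (H : Matrix (Fin N) (Fin N) L)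
      (v : HeightOneSpectrum (𝓞 ↥(maximalRealSubfield L)))
      (μ : @Measure ((cmDatum L N H).Local v) (borel _)), @Measure.IsHaarMeasure _ _ _ (borel _) μ →
      ∀ b : IrrClass ((cmDatum L N H).Local v) → ℂ, (∀ x, b x ≠ 0 → x.IsAdmissible) →
      (∀ t : (cmDatum L N H).Local v → ℂ, IsLocallyConstant t ∧ HasCompactSupport t →
        Summable fun x => b x * (letI : MeasurableSpace ((cmDatum L N H).Local v) := borel _; x.smoothTrace μ t)) →
      (Function.support b).Countable)
    (h4 : ∀ {α : Type} (S : Finset α) {I : Type 1} {Φ₀ : Type} (U : Set I) (P₀ : Φ₀ → Prop) (Θ : I → Φ₀ → ℂ)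
      {X : α → Type 1} {T : α → Type} (W : ∀ a, Set (X a)) (P : ∀ a, T a → Prop) (Ξ : ∀ a, X a → T a → ℂ),
      (∀ b : I → ℂ, (∀ i, b i ≠ 0 → i ∈ U) → (∀ φ, P₀ φ → Summable fun i => b i * Θ i φ) →
        (∀ φ, P₀ φ → ∑' i, b i * Θ i φ = 0) → ∀ i, b i = 0) →
      (∀ a ∈ S, ∀ b : X a → ℂ, (∀ x, b x ≠ 0 → x ∈ W a) → (∀ t, P a t → Summable fun x => b x * Ξ a x t) →
        (∀ t, P a t → ∑' x, b x * Ξ a x t = 0) → ∀ x, b x = 0) →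
      ∀ a : I × (∀ s : ↥S, X s) → ℂ,
        (∀ x, a x ≠ 0 → x.1 ∈ U ∧ ∀ s : ↥S, x.2 s ∈ W s) →
        (∀ (φ : Φ₀) (t : ∀ s : ↥S, T s), P₀ φ → (∀ s : ↥S, P s (t s)) →
          Summable fun x => a x * (Θ x.1 φ * ∏ s : ↥S, Ξ s (x.2 s) (t s))) →
        (∀ (φ : Φ₀) (t : ∀ s : ↥S, T s), P₀ φ → (∀ s : ↥S, P s (t s)) →
          ∑' x, a x * (Θ x.1 φ * ∏ s : ↥S, Ξ s (x.2 s) (t s)) = 0) →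
        ∀ x, a x = 0) :
    ∀ (L : Type) [Field L] [NumberField L] [IsCMField L] (ι : L →+* ℂ) (H : Matrix (Fin 3) (Fin 3) L) (T : GL (Fin 3) ℂ)
      (hT : (T : Matrix (Fin 3) (Fin 3) ℂ)ᴴ * H.map ι * (T : Matrix (Fin 3) (Fin 3) ℂ) = Literature.Geometry.ComplexHyperbolic.BallModel.J)
      (νinf : @Measure (UnitaryGroup.arch (↥(maximalRealSubfield L)) L (IsCMField.complexConj L) 3 H) (borel _))
      (μv : ∀ v : HeightOneSpectrum (𝓞 ↥(maximalRealSubfield L)), @Measure ((cmDatum L 3 H).Local v) (borel _)),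
      SemilocalCharactersLinIndep L ι H T hT νinf μv := by
  intro L _ _ _ ι H T hT νinf μv hdef hν hμ S a ha hs h0
  obtain ⟨hH, hHd⟩ := h3' L ι H T hT
  refine h4 S (U := {y : GKIrrClass (uFormGroup (Fin 2) (Fin 1)) |
      ∃ r : GKIrrep (uFormGroup (Fin 2) (Fin 1)), GKIrrClass.mk r = y ∧ IsAdmissibleGK r.ρK ∧ r.IsInfUnitaryAlongP})
    (P₀ := ArchTestKc L ι H T hT) (Θ := fun y φ => archTr₀ L ι H T hT νinf y φ)
    (X := fun w => IrrClass ((cmDatum L 3 H).Local w)) (T := fun w => (cmDatum L 3 H).Local w → ℂ)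
    (W := fun w => {x | x.IsUnitarizable}) (P := fun w t => IsLocallyConstant t ∧ HasCompactSupport t)
    (Ξ := fun w x t => (letI : MeasurableSpace ((cmDatum L 3 H).Local w) := borel _; x.smoothTrace (μv w) t))
    ?_ ?_ a ?_ ?_ ?_
  · exact h1 L ι H T hT νinf hdef hν
  · intro w _ b hb hsb h0b
    exact local_eq_zero L 3 H w (μv w) (hμ w) (h3 L H hH hHd w) (h7 L 3 H w (μv w) (hμ w)) b hb hsb h0b
  · intro x hx
    exact ha x hx
  · intro φ t hφ ht
    exact hs φ t hφ ht
  · intro φ t hφ ht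
    exact h0 φ t hφ ht

/-! ## §3 The hypothesis-free heads -/

/-- **#85 (L2-SA) AT EVERY FRAME AND EVERY PAIR OF MEASURES, HYPOTHESIS-FREE** — the closer's `StubL2SA` body token for token: the five input texts of
`semilocalCharactersLinIndep_of_letters` discharged by ★ `F0T1aArchRealCaseU21.archCharactersLinIndep_of_letters_u21` (over ★ C1′ ∘ ★ V19 at `U(2,1)`, ★ A6 at `U(2,1)`
`hasUnitaryGlobalization_of_isInfUnitary_uTwoOne`, ★ A7′ `unitaryGlobalizationIrreducible_holds`), ★ `localIrrepAdmissible_three_all`, ★ `Rogawski1990.isUnit_det_of_frame`,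
★ `countable_support_of_summable_mul_smoothTrace_cmDatum`, ★ `eq_zero_of_piFinset`. [cite: Rogawski1990, Prop. 13.8.1 p. 212] [cite: JacquetLanglands1970, Lemma 16.1.1]
[cite: LabesseLanglands1979, Lemma 6.1 pp. 768–769] -/
theorem semilocalCharactersLinIndep_all :
    ∀ (L : Type) [Field L] [NumberField L] [IsCMField L] (ι : L →+* ℂ) (H : Matrix (Fin 3) (Fin 3) L) (T : GL (Fin 3) ℂ)
      (hT : (T : Matrix (Fin 3) (Fin 3) ℂ)ᴴ * H.map ι * (T : Matrix (Fin 3) (Fin 3) ℂ) = Literature.Geometry.ComplexHyperbolic.BallModel.J)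
      (νinf : @Measure (UnitaryGroup.arch (↥(maximalRealSubfield L)) L (IsCMField.complexConj L) 3 H) (borel _))
      (μv : ∀ v : HeightOneSpectrum (𝓞 ↥(maximalRealSubfield L)), @Measure ((cmDatum L 3 H).Local v) (borel _)),
      SemilocalCharactersLinIndep L ι H T hT νinf μv :=
  semilocalCharactersLinIndep_of_letters
    (fun L _ _ _ ι H T hT νinf hdef hν b hb hs h0 y =>
      (F0T1aArchRealCaseU21.archCharactersLinIndep_of_letters_u21
        (archIntegratedOperatorTraceClass_forall_of_kTypeGrowthU21 kTypeGrowth_uTwoOne)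
        hasUnitaryGlobalization_of_isInfUnitary_uTwoOne unitaryGlobalizationIrreducible_holds L ι H T hT νinf).eq_zero hdef hν b hb hs h0 y)
    (fun L _ _ _ H hH hHd v c => F0P3LocalIrrepAdmissibleThree.localIrrepAdmissible_three_all L H hH hHd v c)
    (fun L _ _ _ ι H T hT => ⟨Literature.NumberTheory.Rogawski1990.transpose_map_cmConjRingHom_eq_of_frame L ι H T hT,
      Literature.NumberTheory.Rogawski1990.isUnit_det_of_frame L ι H T hT⟩)   -- ★ `GlobalAPacketMembership` (NOT ★ `CMFrameHermitian`, whose `UnitaryGroup.`-namesake would be ambiguous in the closer)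
    (fun L _ _ _ N H v μ hμ b hadm hsum => countable_support_of_summable_mul_smoothTrace_cmDatum L N H v μ hμ b hadm hsum)
    (fun {_} S {_} {_} U P₀ Θ {_} {_} W P Ξ hΘ hΞ a ha hs h0 x => eq_zero_of_piFinset S U P₀ Θ W P Ξ hΘ hΞ a ha hs h0 x)

/-- **Read-back at a frame**: the letter #85 itself. [cite: Rogawski1990, Prop. 13.8.1 p. 212] -/
theorem semilocalCharactersLinIndep_holds (L : Type) [Field L] [NumberField L] [IsCMField L] (ι : L →+* ℂ) (H : Matrix (Fin 3) (Fin 3) L) (T : GL (Fin 3) ℂ)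
    (hT : (T : Matrix (Fin 3) (Fin 3) ℂ)ᴴ * H.map ι * (T : Matrix (Fin 3) (Fin 3) ℂ) = Literature.Geometry.ComplexHyperbolic.BallModel.J)
    (νinf : @Measure (UnitaryGroup.arch (↥(maximalRealSubfield L)) L (IsCMField.complexConj L) 3 H) (borel _))
    (μv : ∀ v : HeightOneSpectrum (𝓞 ↥(maximalRealSubfield L)), @Measure ((cmDatum L 3 H).Local v) (borel _)) :
    SemilocalCharactersLinIndep L ι H T hT νinf μv :=
  semilocalCharactersLinIndep_all L ι H T hT νinf μv

end Summit.HodgeConjecture.HodgeConjecture.Cruxes.H413.F0T1bSemilocalCharactersLinIndepOfStubs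

end
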